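import Literature.NumberTheory.Automorphic.SymPowIwahoriCoefficients
import Literature.NumberTheory.Automorphic.HidaLemmaGL2
import Literature.NumberTheory.Automorphic.OrdinaryPartOfFiniteModule
import HarnessLib

/-!
# Independence of weight for the `GL₂` Hida family at the levels `U(b,c)`

Topic `NumberTheory/Automorphic`; namespace `Literature.NumberTheory.Automorphic.BigHeckeGLn`;
theorems only.  Assembly of `SymPowIwahoriCoefficients` (the `GL₂` one-place instance of the
change-of-coefficients machinery: `(λ₁)_*`, `Θ`, `U_v^r`), `HidaTowerLevels` (the levels
`U(b,c) = TameLevel.level b c`) and `OrdinaryPartOfFiniteModule` (Fitting) into the statement of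
**independence of weight** used in the proof of Hida's control theorem
(`hidaControl_dominantOrdinaryPoint`): [KhareThorne2017, §6.4, Prop. 6.13];
[Hida1994AIF, §2, Prop. 2.1].

* `TameLevel.level_le_iwahoriMonoid` — `U(b,c)` lies in the Iwahori monoid modulo `ker red` as soon
  as `red` kills the elements of valuation `≤ |ϖ_v|^c` (e.g. `red : 𝒪_v → 𝒪_v/ϖ^r`, `r ≤ c`).
* `mapsTo_pushforwardCohomology_ordinaryPart`, `mapsTo_raiseCohomology_ordinaryPart` — `(λ₁)_*` and
  `Θ` exchange the `U_v^r`-ordinary parts `⋂ₙ range (U_v^r)ⁿ` (Hecke equivariance).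
* `independenceOfWeight_bijOn_ordinaryPart` — **for FINITE cohomology groups,
  `(λ₁)_* : H^i(U, Sym^m(S²))^{ord} → H^i(U, S(χ_m))^{ord}` is a bijection** (`U` any level in the
  Iwahori monoid, e.g. `U(c,c)` with `c ≥ r`; `red(ϖ_v)^r = 0`).  The finiteness (Borel–Serre /
  compactness of `X_U` for finite coefficients) is the hypothesis `[Finite _]`; the identification
  of `H^i(U, S(χ_m))` with the trivial-coefficient Hida tower twisted by the slot-`1` diamond
  character, and `U_v^r = (U_v)^r`, are not part of this file.

## References

* C. Khare, J. A. Thorne, *Potential automorphy and the Leopoldt conjecture*, Amer. J. Math. 139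
  (2017), §6.4, Prop. 6.13 (arXiv:1409.7007, held; read 2026-08-16). [KhareThorne2017]
* H. Hida, *p-adic ordinary Hecke algebras for GL(2)*, Ann. Inst. Fourier 44 (1994), §2, Prop. 2.1
  (held). [Hida1994AIF]
-/

noncomputable section

open IsDedekindDomain NumberField

namespace Literature.NumberTheory.Automorphic.BigHeckeGLn

open LevelAction IntegralWeightGL2

variable {K : Type} [Field K] [NumberField K] {p : ℕ} [Fact p.Prime] (𝒰 : TameLevel 2 K p)
  {v : HeightOneSpectrum (𝓞 K)} {S : Type} [CommRing S] (red : v.adicCompletionIntegers K →+* S)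

namespace TameLevel

/-- **`U(b,c)` lies in the Iwahori monoid modulo `ker red`** when `red` kills the elements of
valuation `≤ |ϖ_v|^c` (the entries of `u_v` below the diagonal). [cite: KhareThorne2017, §6.4] -/
theorem level_le_iwahoriMonoid (hv : (p : 𝓞 K) ∈ v.asIdeal) {b c : ℕ}
    (hred : ∀ x : v.adicCompletionIntegers K,
      Valued.v (x : v.adicCompletion K) ≤ (WithZero.exp (-(c : ℤ)) : WithZero (Multiplicative ℤ)) →
        red x = 0) :
    (𝒰.level b c).toSubmonoid ≤ iwahoriMonoid K v red := fun u hu => by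
  have hloc := ((𝒰.mem_level_iff b c u).1 hu).2 v hv
  have h := (mem_valuedIwahoriSubgroup_iff.1 hloc).1
  refine ⟨fun i j => (HeightOneSpectrum.mem_adicCompletionIntegers (R := 𝓞 K) K v).2 (h.le_one i j),
    ⟨_, (HeightOneSpectrum.mem_adicCompletionIntegers (R := 𝓞 K) K v).2 (h.le_one 1 0)⟩,
    hred _ ((h.lower 1 0 (by decide)).trans (min_le_right _ _)), rfl⟩

end TameLevel

/-! ### The ordinary parts are exchanged -/

section Ordinary

variable {Γ : Type} [Group Γ] (ι : Γ →* FiniteAdelicGL 2 K) (m : ℕ)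
  {U : Subgroup (FiniteAdelicGL 2 K)} (hU : U.toSubmonoid ≤ iwahoriMonoid K v red) (r : ℕ) (i : ℕ)

/-- `(λ₁)_*` maps the `U_v^r`-ordinary part of `H^i(U, Sym^m(S²))` into that of `H^i(U, S(χ_m))`
(Hecke equivariance). [folklore] -/
theorem mapsTo_pushforwardCohomology_ordinaryPart :
    Set.MapsTo (pushforwardCohomology ι (iwahoriMonoid K v red) (symPowCoeff K v red m)
        (lowChar K v red m) U (coeffX₁ S m) (coeffX₁_comp_symPowCoeff m) i).hom
      (⨅ n : ℕ, LinearMap.range (heckeCohomology ι (iwahoriMonoid K v red) (symPowCoeff K v red m) U hU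
        (heckeElement_pow_mem_iwahoriMonoid K v red r) i ^ n) : Submodule S _)
      (⨅ n : ℕ, LinearMap.range (heckeCohomology ι (iwahoriMonoid K v red) (lowChar K v red m) U hU
        (heckeElement_pow_mem_iwahoriMonoid K v red r) i ^ n) : Submodule S _) :=
  mapsTo_iInf_range_pow_of_comp_eq
    (heckeCohomology_comp_pushforwardCohomology ι _ _ _ U _ _ hU _ i)

/-- `Θ` maps the `U_v^r`-ordinary part of `H^i(U, S(χ_m))` into that of `H^i(U, Sym^m(S²))`
(Hecke equivariance of `Θ`). [folklore] -/
theorem mapsTo_raiseCohomology_ordinaryPart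
    (hr : red ⟨_, uniformizerAt_mem_adicCompletionIntegers K v⟩ ^ r = 0) :
    Set.MapsTo (raiseCohomology ι (iwahoriMonoid K v red) (symPowCoeff K v red m)
        (lowChar K v red m) U (smulX₁pow S m) (heckeElement 2 K v 1 ^ r) (coeffX₁ S m)
        (coeffX₁_comp_symPowCoeff m) (coeffX₁_comp_smulX₁pow S m) hU
        (heckeElement_pow_mem_iwahoriMonoid K v red r)
        (heckeFactorsThrough_of_redMatrix_col_zero m hU (heckeElement_pow_mem_iwahoriMonoid K v red r)
          (redMatrix_heckeElement_pow_col_zero K v red r hr)) i).hom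
      (⨅ n : ℕ, LinearMap.range (heckeCohomology ι (iwahoriMonoid K v red) (lowChar K v red m) U hU
        (heckeElement_pow_mem_iwahoriMonoid K v red r) i ^ n) : Submodule S _)
      (⨅ n : ℕ, LinearMap.range (heckeCohomology ι (iwahoriMonoid K v red) (symPowCoeff K v red m) U hU
        (heckeElement_pow_mem_iwahoriMonoid K v red r) i ^ n) : Submodule S _) :=
  mapsTo_iInf_range_pow_of_comp_eq
    (raiseCohomology_comp_heckeCohomology ι _ _ _ U _ _ _ _ _ hU _ _ i)

/-- **Independence of weight for `GL₂` (finite coefficients, one place).**  For a level `U` in the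
Iwahori monoid modulo `ker red` (e.g. `U(c,c)`, `c ≥ r`, `TameLevel.level_le_iwahoriMonoid`) and
`red(ϖ_v)^r = 0`, if the cohomology groups `H^i(U, Sym^m(S²))` and `H^i(U, S(χ_m))` are finite then
`(λ₁)_*` restricts to a bijection of their `U_v^r`-ordinary parts
`⋂ₙ range (U_v^r)ⁿ`. [cite: KhareThorne2017, §6.4, Prop. 6.13] [cite: Hida1994AIF, §2, Prop. 2.1] -/
theorem independenceOfWeight_bijOn_ordinaryPart
    (hr : red ⟨_, uniformizerAt_mem_adicCompletionIntegers K v⟩ ^ r = 0)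
    [Finite (cohomology ι (iwahoriMonoid K v red) (symPowCoeff K v red m) U i)]
    [Finite (cohomology ι (iwahoriMonoid K v red) (lowChar K v red m) U i)] :
    Set.BijOn (pushforwardCohomology ι (iwahoriMonoid K v red) (symPowCoeff K v red m)
        (lowChar K v red m) U (coeffX₁ S m) (coeffX₁_comp_symPowCoeff m) i).hom
      (⨅ n : ℕ, LinearMap.range (heckeCohomology ι (iwahoriMonoid K v red) (symPowCoeff K v red m) U hU
        (heckeElement_pow_mem_iwahoriMonoid K v red r) i ^ n) : Submodule S _)
      (⨅ n : ℕ, LinearMap.range (heckeCohomology ι (iwahoriMonoid K v red) (lowChar K v red m) U hU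
        (heckeElement_pow_mem_iwahoriMonoid K v red r) i ^ n) : Submodule S _) :=
  independenceOfWeight_bijOn K v red ι m hU r hr i
    (mapsTo_pushforwardCohomology_ordinaryPart red ι m hU r i)
    (mapsTo_raiseCohomology_ordinaryPart red ι m hU r i hr)
    (injOn_iInf_range_pow _) (surjOn_iInf_range_pow _)

end Ordinary

end Literature.NumberTheory.Automorphic.BigHeckeGLn
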